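import Literature.Computability.Complexity.LabelCoverFromConstraintGraph
import Literature.Computability.Complexity.OneShotPreprocessing
import Literature.Computability.Complexity.ArityReduction
import Literature.Computability.Complexity.CNFToBCSP
import Literature.Computability.Complexity.CNFInvariance
import Literature.Computability.Complexity.Approximation
import Literature.Computability.Complexity.PromiseProofs
import HarnessLib

/-!
# From gap-E3SAT to gap label cover of every soundness error: the one-shot reduction, at the instance level

Topic `Computability/Complexity`, namespace `Literature.Computability.Complexity.Expander.E3LC`.  The
tree's route from the PCP theorem in Håstad/Dinur form — NP-hardness of `gapE3SAT η` for some `η < 1/8`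
(`Approximation.gapE3SAT`, `GapAssembly.gapE3SAT_isNPHard_of_gapMachine`) — to Arora–Barak Thm. 22.15
in the form `∀ ε > 0, ∃ W, (gapLabelCover W ε).IsNPHard` used by `GapSetCoverProofs` and
`KhotSVPHardnessProofs`, as ONE Karp reduction whose polynomial-time machine is elementary (complete graphs
in place of expander families), proved correct here at the level of instances, leaving exactly the
machine statement `∃ f ∈ FP, ∀ ψ, f (code ψ) = code (e3Inst ε₁ ε' ψ)`:

1. an E3-CNF `ψ` with `m ≥ 1` clauses ↦ `BCSP.ofCNF 3 ψ`, with the quantitative gap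
   `val(ψ) ≤ 1 - ε₁ ⇒` every Boolean assignment violates `≥ ε₁ m` constraints (`viol_ofCNF_ge`);
2. arity reduction (Arora–Barak Claim 22.36, `ArityReduction.lean`): `3m` binary constraints `edges ψ`,
   `rel ψ` over the alphabet `[8]`, every assignment violating `≥ ⌈ε₁ m⌉`;
3. one-shot degree reduction + expanderization with complete graphs (`OneShotPreprocessing.lean`):
   the regular constraint graph `graph ψ : RotGraph (6m) D` with constraints `cons ψ`, violated fraction
   `≥ ε₁/120`, `λ ≤ 1/2`, satisfiable (values `< 8`) if `ψ` is (`graph_sat`, `graph_gap`, `graph_spectral`);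
4. the dart game, Dinur–Steurer parallel repetition and the regular list rendering
   (`LabelCoverFromConstraintGraph.dartLC`): `e3LC ψ k`, in `yesSet (64^k)` if `ψ` is satisfiable, in
   `noSet (64^k) ε'` if `val(ψ) ≤ 1 - ε₁`, every dart accepts something and `base ε₁ ^ k < ε'`;
5. the instance map `e3Inst` (empty formula ↦ fixed YES instance; non-E3 or a dart accepting nothing ↦
   fixed NO instance `constLC`, the test being the Boolean `haccTest`), `e3Inst_mem_yesSet` / `e3Inst_mem_noSet`, and
   **`polyTimeReducible_gapE3SAT_gapLabelCover`**: if some `f ∈ FP` computes `e3Inst ε₁ ε'` on codes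
   (`f (code ψ) = code (e3Inst ε₁ ε' ψ)` for every CNF `ψ`) then `gapE3SAT (1/8 - ε₁) ≤ₚ gapLabelCover (64^{k(ε₁,ε')}) ε'`;
   hence **`isNPHard_gapLabelCover_forall_of_gapE3SAT`**: NP-hardness of `gapE3SAT (1/8 - ε₁)` (`0 < ε₁ ≤ 1/8`)
   and these machines give `∀ ε > 0, ∃ W, (gapLabelCover W ε).IsNPHard`.

## References

* S. Arora, B. Barak, *Computational Complexity: A Modern Approach*, CUP 2009: Thm. 22.15, §22.A
  (Claims 22.36–22.38), §11.3.1.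
* I. Dinur, D. Steurer, *Analytical approach to parallel repetition*, STOC 2014; arXiv:1305.1979, §3.3.
* J. Håstad, *Some optimal inapproximability results*, J. ACM 48 (2001), Thm. 6.5 (gap-E3SAT).
-/

noncomputable section

namespace Literature.Computability.Complexity

open Finset _root_.Computability

/-- `countP` as the sum of indicators. [folklore] -/
theorem List.countP_eq_sum_map_ite {α : Type*} (p : α → Bool) : ∀ l : List α, l.countP p = (l.map fun a => if p a = true then 1 else 0).sum
  | [] => rfl
  | a :: l => by
    rw [List.countP_cons, List.map_cons, List.sum_cons, List.countP_eq_sum_map_ite p l]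
    by_cases h : p a = true <;> simp [h, Nat.add_comm]

/-- Counting the positions of a list with a property is `countP`. [folklore] -/
theorem card_filter_fin_eq_countP {α : Type*} (p : α → Bool) (l : List α) :
    (univ.filter fun s : Fin l.length => p l[s.val] = true).card = l.countP p := by
  rw [card_filter, List.countP_eq_sum_map_ite, ← Fin.sum_univ_fun_getElem l fun a => if p a = true then 1 else 0]

namespace Expander

open RotGraph DegreeReduction ArityReduction

/-! ### Step 1: the quantitative gap of `ofCNF` -/

namespace BCSP

/-- **A CNF of width `≤ q` and value `≤ 1 - ε` gives a `BCSP q` instance in which every Boolean assignment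
violates at least `ε m` of the `m` constraints.** [cite: AroraBarakCC2009, §11.3.1 and Def. 11.1 (val(φ))] -/
theorem viol_ofCNF_ge (q : ℕ) {ψ : CNF ℕ} (hw : ψ.IsWidthLE q) {ε : ℝ} (h : (ψ.maxSatFraction : ℝ) ≤ 1 - ε)
    (σ' : Fin (ofCNF q ψ).nV → Bool) : ε * ψ.length ≤ ((ofCNF q ψ).viol σ' : ℝ) := by
  classical
  rcases Nat.eq_zero_or_pos ψ.length with h0 | hm
  · rw [h0, Nat.cast_zero, mul_zero]; exact Nat.cast_nonneg _
  set L := (ofCNF q ψ).cons.length with hL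
  have hLm : L = ψ.length := ofCNF_length q ψ
  -- accepted constraints are the clauses true under the restricted assignment
  have hacc : (univ.filter fun s : Fin L => (ofCNF q ψ).acc s (σ' ∘ (ofCNF q ψ).vars s) = true).card =
      (univ.filter fun s : Fin L => Clause.eval (restr q ψ σ') (ψ[s.val]'(lt_length_of_fin q s)) = true).card := by
    congr 1
    ext s
    simp only [mem_filter, mem_univ, true_and]
    exact acc_ofCNF_iff q s (hw _ (List.getElem_mem _)) σ'
  have hcount : (univ.filter fun s : Fin L => Clause.eval (restr q ψ σ') (ψ[s.val]'(lt_length_of_fin q s)) = true).card =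
      ψ.countP fun c => Clause.eval (restr q ψ σ') c := by
    rw [← card_filter_fin_eq_countP]
    refine card_equiv (finCongr hLm) fun s => ?_
    simp only [mem_filter, mem_univ, true_and, finCongr_apply]
    rfl
  have hsplit : (univ.filter fun s : Fin L => (ofCNF q ψ).acc s (σ' ∘ (ofCNF q ψ).vars s) = true).card + (ofCNF q ψ).viol σ' = L := by
    unfold BCSP.viol
    have := card_filter_add_card_filter_not (s := (univ : Finset (Fin L)))
      (fun s : Fin L => (ofCNF q ψ).acc s (σ' ∘ (ofCNF q ψ).vars s) = true)
    rw [card_univ, Fintype.card_fin] at this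
    convert this using 2
    congr 1
    ext s
    simp only [mem_filter, mem_univ, true_and, Bool.not_eq_true]
  -- `countP ≤ (1 - ε) m` from the value
  have hfrac := (ψ.satisfiedFraction_le_maxSatFraction (restr q ψ σ'))
  have hfracR : ((ψ.satisfiedFraction (restr q ψ σ') : ℚ) : ℝ) ≤ 1 - ε := le_trans (by exact_mod_cast hfrac) h
  unfold CNF.satisfiedFraction CNF.numClauses at hfracR
  rw [if_neg hm.ne'] at hfracR
  push_cast at hfracR
  have hmR : (0 : ℝ) < ψ.length := by exact_mod_cast hm
  rw [div_le_iff₀ hmR] at hfracR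
  have hsplitR : ((ψ.countP fun c => Clause.eval (restr q ψ σ') c : ℕ) : ℝ) + ((ofCNF q ψ).viol σ' : ℝ) = ψ.length := by
    rw [← hcount, ← hacc, ← hLm]; exact_mod_cast hsplit
  linarith

end BCSP

/-! ### Steps 2–3: the regular expanding constraint graph of an E3-CNF -/

namespace E3LC

variable (ψ : CNF ℕ)

/-- The Boolean constraint system of `ψ` (one ternary constraint per clause). [cite: AroraBarakCC2009, §11.3.1] -/
abbrev bcsp : BCSP 3 := BCSP.ofCNF 3 ψ

/-- Number of variables after arity reduction: CNF variables, the dummy, and one `y_s` per clause. [cite: AroraBarakCC2009, Claim 22.36] -/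
abbrev n₀ : ℕ := (bcsp ψ).nV + (bcsp ψ).cons.length

/-- Number of binary constraints after arity reduction: `3` per clause. [cite: AroraBarakCC2009, Claim 22.36] -/
abbrev m₁ : ℕ := (bcsp ψ).cons.length * 3

/-- The ordered pairs of the binary constraints. [cite: AroraBarakCC2009, Claim 22.36] -/
def edges : Fin (m₁ ψ) → Fin (n₀ ψ) × Fin (n₀ ψ) := arEdge (bcsp ψ).vars

/-- The relations of the binary constraints (alphabet `[8]`). [cite: AroraBarakCC2009, Claim 22.36] -/
def rel : Fin (m₁ ψ) → ℕ → ℕ → Bool := arR (bcsp ψ).acc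

/-- Number of vertices of the constraint graph: the `2 · 3m` occurrences. [cite: AroraBarakCC2009, Claim 22.37] -/
abbrev N : ℕ := m₁ ψ * 2

/-- Degree of the constraint graph. [folklore] -/
abbrev D : ℕ := osD (m₁ ψ) * (m₁ ψ * 2) + (m₁ ψ * 2) * osD (m₁ ψ)

/-- **The regular expanding constraint graph of `ψ`** (one-shot degree reduction and expanderization with complete graphs).
[cite: AroraBarakCC2009, Claims 22.37–22.38] -/
def graph : RotGraph (N ψ) (D ψ) := exGraph (edges ψ)

/-- Its dart constraints. [cite: AroraBarakCC2009, Claims 22.37–22.38] -/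
def cons : Fin (N ψ) → Fin (D ψ) → ℕ → ℕ → Bool := exC (rel ψ)

/-- `m₁ = 3m`. [folklore] -/
theorem m₁_eq : m₁ ψ = ψ.length * 3 := by
  show (BCSP.ofCNF 3 ψ).cons.length * 3 = ψ.length * 3
  rw [BCSP.ofCNF_length]

/-- The degree is positive when `ψ` has a clause. [folklore] -/
theorem D_pos (hm : 0 < ψ.length) : 0 < D ψ := by
  have h1 : 0 < m₁ ψ := by rw [m₁_eq]; positivity
  have h2 : 0 < osD (m₁ ψ) := by unfold osD; positivity
  exact Nat.add_pos_left (Nat.mul_pos h2 (by positivity)) _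

/-- The vertex count is positive when `ψ` has a clause. [folklore] -/
theorem N_pos (hm : 0 < ψ.length) : 0 < N ψ := by
  have h1 : 0 < m₁ ψ := by rw [m₁_eq]; positivity
  show 0 < m₁ ψ * 2
  positivity

/-- **Completeness**: a satisfiable CNF of width `≤ 3` gives an assignment with values `< 8` satisfying every dart.
[cite: AroraBarakCC2009, Claims 22.36–22.38 (completeness)] -/
theorem graph_sat {ψ : CNF ℕ} (hw : ψ.IsWidthLE 3) (h : ψ.Satisfiable) :
    ∃ σ : Fin (N ψ) → ℕ, (∀ u, σ u < 8) ∧ ∀ v i, cons ψ v i (σ v) (σ ((graph ψ).nbr v i)) = true := by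
  obtain ⟨τ, hτ⟩ := BCSP.ofCNF_sat 3 hw h
  refine ⟨liftOcc (edges ψ) (arLift (bcsp ψ).vars τ), fun u => ?_, fun v i => ?_⟩
  · exact lt_of_lt_of_eq (arLift_lt (bcsp ψ).vars (by norm_num : 0 < 3) τ _) (by norm_num)
  · exact exC_lift (edges ψ) (rel ψ) (fun s => arR_arLift (bcsp ψ).vars (bcsp ψ).acc hτ s) v i

/-- **Soundness (gap)**: if `ψ` has width `≤ 3`, `m ≥ 1` clauses and value `≤ 1 - ε₁` (`0 ≤ ε₁`), every assignment
with values `< 8` violates at least an `ε₁/120`-fraction of the `N · D` darts. [cite: AroraBarakCC2009, Claims 22.36–22.38 (soundness)] -/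
theorem graph_gap {ψ : CNF ℕ} (hw : ψ.IsWidthLE 3) {ε₁ : ℝ} (hε₁ : 0 ≤ ε₁) (hval : (ψ.maxSatFraction : ℝ) ≤ 1 - ε₁)
    (σ : Fin (N ψ) → ℕ) (hσ : ∀ u, σ u < 8) :
    ε₁ / 120 * ((N ψ : ℝ) * (D ψ : ℝ)) ≤
      ((univ.filter fun x : Fin (N ψ) × Fin (D ψ) => cons ψ x.1 x.2 (σ x.1) (σ ((graph ψ).nbr x.1 x.2)) = false).card : ℝ) := by
  -- Step 1: Boolean assignments violate `≥ ε₁ m`, hence `≥ ⌈ε₁ m⌉`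
  have hB : ∀ σ' : Fin (bcsp ψ).nV → Bool, ⌈ε₁ * ψ.length⌉₊ ≤
      (univ.filter fun s => (bcsp ψ).acc s (σ' ∘ (bcsp ψ).vars s) = false).card := fun σ' =>
    Nat.ceil_le.2 (BCSP.viol_ofCNF_ge 3 hw hval σ')
  -- Step 2: arity reduction
  have hA : ∀ σ' : Fin (n₀ ψ) → ℕ, (∀ u, σ' u < 8) →
      ε₁ / 3 * (m₁ ψ : ℕ) ≤ ((univ.filter fun s => rel ψ s (σ' (edges ψ s).1) (σ' (edges ψ s).2) = false).card : ℝ) := by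
    intro σ' _
    have h := arityReduction_soundness (bcsp ψ).vars (bcsp ψ).acc (by norm_num : 0 < 3) hB σ'
    have hR : (⌈ε₁ * ψ.length⌉₊ : ℝ) ≤ ((univ.filter fun s => rel ψ s (σ' (edges ψ s).1) (σ' (edges ψ s).2) = false).card : ℝ) := by
      exact_mod_cast h
    refine le_trans ?_ ((Nat.le_ceil _).trans hR)
    rw [m₁_eq]; push_cast; linarith
  -- Step 3: one-shot preprocessing
  have h := ex_soundness (edges ψ) (rel ψ) 8 σ (by norm_num) (by positivity : 0 ≤ ε₁ / 3) hA hσ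
  have hND : (((m₁ ψ * 2 : ℕ) : ℝ) * ((osD (m₁ ψ) * (m₁ ψ * 2) + (m₁ ψ * 2) * osD (m₁ ψ) : ℕ) : ℝ)) = (N ψ : ℝ) * (D ψ : ℝ) := rfl
  rw [hND] at h
  have heq : ε₁ / 3 / 40 = ε₁ / 120 := by ring
  rw [heq] at h
  exact h

/-- **Expansion**: `λ(graph ψ) ≤ 1/2` (`m ≥ 1`). [cite: AroraBarakCC2009, Claim 22.38] -/
theorem graph_spectral {ψ : CNF ℕ} (hm : 0 < ψ.length) : SpectralBound (graph ψ).walkMatrix (1 / 2) :=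
  ex_spectral (edges ψ) (by rw [m₁_eq]; positivity)

/-! ### Step 4: the label cover instances -/

/-- **The label cover instance `e3LC ψ hm k`** over the alphabet `64^k`. [cite: DinurSteurer2014, §3.3; AroraBarakCC2009, Thm. 22.15] -/
def e3LC {ψ : CNF ℕ} (hm : 0 < ψ.length) (k : ℕ) : LabelCoverInstance :=
  (graph ψ).dartLC (cons ψ) 8 (D_pos ψ hm) k

/-- The Boolean test "every dart of `graph ψ` has an accepting pair". [folklore] -/
def haccTest : Bool := decide (∀ (v : Fin (N ψ)) (i : Fin (D ψ)), 0 < (accPairs (cons ψ) 8 v i).length)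

/-- `haccTest` decides the accepting-pairs condition. [folklore] -/
theorem haccTest_eq_true_iff : haccTest ψ = true ↔ ∀ (v : Fin (N ψ)) (i : Fin (D ψ)), 0 < (accPairs (cons ψ) 8 v i).length := by
  unfold haccTest; rw [decide_eq_true_iff]

/-- A satisfiable dart system has accepting pairs everywhere. [folklore] -/
theorem hacc_of_sat {ψ : CNF ℕ} (h : ∃ σ : Fin (N ψ) → ℕ, (∀ u, σ u < 8) ∧ ∀ v i, cons ψ v i (σ v) (σ ((graph ψ).nbr v i)) = true) :
    ∀ (v : Fin (N ψ)) (i : Fin (D ψ)), 0 < (accPairs (cons ψ) 8 v i).length := by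
  obtain ⟨σ, hσ, hsat⟩ := h
  intro v i
  have hmem : ((⟨σ v, hσ v⟩, ⟨σ ((graph ψ).nbr v i), hσ _⟩) : Fin 8 × Fin 8) ∈ accPairs (cons ψ) 8 v i :=
    (mem_accPairs _ _).2 (hsat v i)
  exact List.length_pos_of_mem hmem

/-- The alphabet of `e3LC ψ hm k` is `64^k`. [folklore] -/
theorem e3LC_alphabetSize {ψ : CNF ℕ} (hm : 0 < ψ.length) (k : ℕ) : (e3LC hm k).alphabetSize = 64 ^ k :=
  dartLC_alphabetSize _ _ _ _ k

/-- **YES**: a satisfiable E3-CNF (width `≤ 3`) with a clause is mapped into `yesSet (64^k)`. [cite: DinurSteurer2014, §3.3] -/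
theorem e3LC_mem_yesSet {ψ : CNF ℕ} (hw : ψ.IsWidthLE 3) (hsat : ψ.Satisfiable) (hm : 0 < ψ.length) (k : ℕ) :
    e3LC hm k ∈ GapLabelCover.yesSet (64 ^ k) := by
  obtain ⟨σ, hσ, hσsat⟩ := graph_sat hw hsat
  have h := dartLC_mem_yesSet _ _ _ (D_pos ψ hm) (N_pos ψ hm) (hacc_of_sat ⟨σ, hσ, hσsat⟩) hσ hσsat k
  exact h

/-- **The decay base** for soundness `ε₁`: `√(1 - dsEps ((1 - 1/2)/2) (ε₁/240))`. [cite: DinurSteurer2014, Thm. 3.4] -/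
def base (ε₁ : ℝ) : ℝ := Real.sqrt (1 - ProjGame.dsEps ((1 - 1 / 2) / 2) (ε₁ / 120 / 2))

/-- `0 ≤ base`. [folklore] -/
theorem base_nonneg (ε₁ : ℝ) : 0 ≤ base ε₁ := Real.sqrt_nonneg _

/-- `base < 1` for `ε₁ > 0`. [folklore] -/
theorem base_lt_one {ε₁ : ℝ} (h : 0 < ε₁) : base ε₁ < 1 := sqrt_one_sub_dsEps_lt_one (by norm_num) (by positivity)

/-- **NO**: an E3-CNF (width `≤ 3`) of value `≤ 1 - ε₁` (`0 ≤ ε₁`), with a clause and accepting pairs on every dart,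
is mapped into `noSet (64^k) ε'` whenever `base ε₁ ^ k < ε'`. [cite: DinurSteurer2014, §3.3] -/
theorem e3LC_mem_noSet {ψ : CNF ℕ} (hw : ψ.IsWidthLE 3) {ε₁ : ℝ} (hε₁ : 0 ≤ ε₁) (hε₁2 : ε₁ ≤ 240)
    (hval : (ψ.maxSatFraction : ℝ) ≤ 1 - ε₁) (hm : 0 < ψ.length) (hacc : ∀ (v : Fin (N ψ)) (i : Fin (D ψ)), 0 < (accPairs (cons ψ) 8 v i).length)
    (k : ℕ) {ε' : ℝ}
    (hk : base ε₁ ^ k < ε') : e3LC hm k ∈ GapLabelCover.noSet (64 ^ k) ε' :=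
  dartLC_mem_noSet _ _ _ (D_pos ψ hm) (N_pos ψ hm) hacc (graph_spectral hm) (by norm_num) (by linarith)
    (fun σ hσ => graph_gap hw hε₁ hval σ hσ) k hk

/-! ### Step 5: the maps and the reduction -/

/-- **The constant instances** `constLC W' M`: two variables and the `M` constraints `(0, 1, u ↦ c)`, `c < M` —
regular of degree `M`, and every assignment satisfies at most one of them (the fixed YES/NO targets of the map).
[cite: AroraBarakCC2009, Def. 22.1 and §22.3 (regular projection instances)] -/
def constLC (W' M : ℕ) : LabelCoverInstance := ⟨2, W', (List.range M).map fun c => ⟨0, 1, List.replicate W' c⟩⟩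

/-- `constLC W' M` is well formed for `1 ≤ M ≤ W'`. [cite: AroraBarakCC2009, Def. 22.1] -/
theorem constLC_wellFormed {W' M : ℕ} (hM : 0 < M) (hMW : M ≤ W') : (constLC W' M).WellFormed := by
  refine ⟨by simpa [LabelCoverInstance.numConstraints, constLC] using hM, fun C hC => ?_⟩
  simp only [constLC, List.mem_map, List.mem_range] at hC
  obtain ⟨c, hc, rfl⟩ := hC
  refine ⟨show 0 < 2 by norm_num, show 1 < 2 by norm_num, show (0 : ℕ) ≠ 1 by norm_num, List.length_replicate, fun v hv => ?_⟩
  rw [List.mem_replicate] at hv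
  rw [hv.2]
  exact lt_of_lt_of_le hc hMW

/-- `constLC W' M` is regular. [cite: AroraBarakCC2009, §22.3] -/
theorem constLC_isRegular (W' M : ℕ) : (constLC W' M).IsRegular := by
  refine ⟨M, fun i hi => ?_⟩
  simp only [constLC] at hi
  simp only [LabelCoverInstance.degree, constLC, List.countP_map]
  interval_cases i <;> simp [Function.comp_def]

/-- Every assignment satisfies at most one constraint of `constLC W' M`. [folklore] -/
theorem satCount_constLC_le (W' M : ℕ) (a : ℕ → ℕ) : (constLC W' M).satCount a ≤ 1 := by
  unfold LabelCoverInstance.satCount constLC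
  simp only [List.countP_map]
  calc (List.range M).countP ((fun C : LabelCoverConstraint => C.Sat a) ∘ fun c => (⟨0, 1, List.replicate W' c⟩ : LabelCoverConstraint))
      ≤ (List.range M).countP (fun c => c == a 1) := by
        refine List.countP_mono_left fun c _ h => ?_
        simp only [Function.comp_apply] at h
        obtain ⟨hlt, heq⟩ := LabelCoverConstraint.projAt_eq_of_sat h
        simp only [List.length_replicate] at hlt
        simp only [LabelCoverConstraint.projAt, List.getD_eq_getElem?_getD, List.getElem?_replicate, if_pos hlt,
          Option.getD_some] at heq
        simp [heq]
    _ = (List.range M).count (a 1) := rfl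
    _ ≤ 1 := List.nodup_iff_count_le_one.1 List.nodup_range _

/-- **`constLC W' M` is a NO instance** when `1 ≤ M ≤ W'` and `ε M > 1`. [cite: AroraBarakCC2009, Def. 11.13] -/
theorem constLC_mem_noSet {W' M : ℕ} (hM : 0 < M) (hMW : M ≤ W') {ε : ℝ} (hε : 1 < ε * M) :
    constLC W' M ∈ GapLabelCover.noSet W' ε := by
  refine ⟨constLC_wellFormed hM hMW, rfl, constLC_isRegular W' M, fun a => ?_⟩
  have h1 : ((constLC W' M).satCount a : ℝ) ≤ 1 := by exact_mod_cast satCount_constLC_le W' M a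
  have hm : ((constLC W' M).numConstraints : ℝ) = M := by simp [LabelCoverInstance.numConstraints, constLC]
  rw [hm]
  exact lt_of_le_of_lt h1 hε

/-- **`constLC W' 1` is a YES instance** when `W' ≥ 1`. [cite: AroraBarakCC2009, Def. 11.13] -/
theorem constLC_one_mem_yesSet {W' : ℕ} (hW : 0 < W') : constLC W' 1 ∈ GapLabelCover.yesSet W' := by
  refine ⟨constLC_wellFormed one_pos hW, rfl, constLC_isRegular W' 1, fun _ => 0, fun C hC => ?_⟩
  simp only [constLC, List.range_succ, List.range_zero, List.nil_append, List.map_cons, List.map_nil, List.mem_singleton] at hC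
  subst hC
  exact LabelCoverConstraint.sat_of_projAt_eq (by simpa using hW)
    (by simp [LabelCoverConstraint.projAt, List.getD_eq_getElem?_getD, hW])

/-- For every `ε₁ > 0` and `ε' > 0` some exponent `k` has `base ε₁ ^ k < ε'` and `ε' · 64^k > 1`. [cite: DinurSteurer2014, §3.3 (k = O(log(1/δ)/ε))] -/
theorem exists_kOf {ε₁ ε' : ℝ} (hε₁ : 0 < ε₁) (hε' : 0 < ε') : ∃ k : ℕ, base ε₁ ^ k < ε' ∧ 1 < ε' * (64 : ℝ) ^ k := by
  obtain ⟨k₁, hk₁⟩ := exists_pow_lt_of_lt_one hε' (base_lt_one hε₁)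
  obtain ⟨k₂, hk₂⟩ := pow_unbounded_of_one_lt (1 / ε') (by norm_num : (1 : ℝ) < 64)
  refine ⟨max k₁ k₂, ?_, ?_⟩
  · exact lt_of_le_of_lt (pow_le_pow_of_le_one (base_nonneg ε₁) (base_lt_one hε₁).le (le_max_left _ _)) hk₁
  · have h2 : (64 : ℝ) ^ k₂ ≤ (64 : ℝ) ^ max k₁ k₂ := pow_le_pow_right₀ (by norm_num) (le_max_right _ _)
    rw [div_lt_iff₀ hε'] at hk₂
    nlinarith

open Classical in
/-- **The exponent `k(ε₁, ε')`** (least; `0` if none). [cite: DinurSteurer2014, §3.3] -/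
def kOf (ε₁ ε' : ℝ) : ℕ := if h : ∃ k : ℕ, base ε₁ ^ k < ε' ∧ 1 < ε' * (64 : ℝ) ^ k then Nat.find h else 0

open Classical in
/-- The defining property of `kOf`. [folklore] -/
theorem kOf_spec {ε₁ ε' : ℝ} (hε₁ : 0 < ε₁) (hε' : 0 < ε') : base ε₁ ^ kOf ε₁ ε' < ε' ∧ 1 < ε' * (64 : ℝ) ^ kOf ε₁ ε' := by
  unfold kOf
  rw [dif_pos (exists_kOf hε₁ hε')]
  exact Nat.find_spec (exists_kOf hε₁ hε')

/-- **The alphabet `W(ε₁, ε') = 64^{k(ε₁, ε')}`**. [cite: AroraBarakCC2009, Thm. 22.15] -/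
def Wk (ε₁ ε' : ℝ) : ℕ := 64 ^ kOf ε₁ ε'

/-- `W(ε₁, ε') ≥ 1`. [folklore] -/
theorem Wk_pos (ε₁ ε' : ℝ) : 0 < Wk ε₁ ε' := pow_pos (by norm_num) _

/-- **The instance map**: E3-CNFs with a clause and accepting pairs everywhere go through `e3LC`; the empty
formula to the fixed YES instance; everything else to the fixed NO instance. [cite: AroraBarakCC2009, Thm. 22.15] -/
def e3Inst (ε₁ ε' : ℝ) (ψ : CNF ℕ) : LabelCoverInstance :=
  if ψ.IsExactWidth 3 then
    if hm : 0 < ψ.length then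
      if haccTest ψ then e3LC hm (kOf ε₁ ε') else constLC (Wk ε₁ ε') (Wk ε₁ ε')
    else constLC (Wk ε₁ ε') 1
  else constLC (Wk ε₁ ε') (Wk ε₁ ε')

/-- **YES instances of gap-E3SAT go to YES instances** (instance level). [cite: AroraBarakCC2009, Thm. 22.15] -/
theorem e3Inst_mem_yesSet (ε₁ ε' : ℝ) {ψ : CNF ℕ} (hE : ψ.IsExactWidth 3) (hsat : ψ.Satisfiable) :
    e3Inst ε₁ ε' ψ ∈ GapLabelCover.yesSet (Wk ε₁ ε') := by
  unfold e3Inst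
  rw [if_pos hE]
  rcases Nat.eq_zero_or_pos ψ.length with h0 | h0
  · rw [dif_neg (by rw [h0]; exact lt_irrefl 0)]
    exact constLC_one_mem_yesSet (Wk_pos ε₁ ε')
  · rw [dif_pos h0, if_pos ((haccTest_eq_true_iff ψ).2 (hacc_of_sat (graph_sat hE.isWidthLE hsat)))]
    exact e3LC_mem_yesSet hE.isWidthLE hsat h0 _

/-- **NO instances of gap-E3SAT go to NO instances** (instance level; `0 < ε₁ ≤ 240`, `0 < ε'`): an E3-CNF of
value `≤ 1 - ε₁`. [cite: AroraBarakCC2009, Thm. 22.15] -/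
theorem e3Inst_mem_noSet {ε₁ ε' : ℝ} (hε₁ : 0 < ε₁) (hε₁2 : ε₁ ≤ 240) (hε' : 0 < ε') {ψ : CNF ℕ} (hE : ψ.IsExactWidth 3)
    (hval : (ψ.maxSatFraction : ℝ) ≤ 1 - ε₁) : e3Inst ε₁ ε' ψ ∈ GapLabelCover.noSet (Wk ε₁ ε') ε' := by
  have hNO : constLC (Wk ε₁ ε') (Wk ε₁ ε') ∈ GapLabelCover.noSet (Wk ε₁ ε') ε' :=
    constLC_mem_noSet (Wk_pos ε₁ ε') le_rfl (by have := (kOf_spec hε₁ hε').2; unfold Wk; push_cast; exact this)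
  unfold e3Inst
  rw [if_pos hE]
  have hm : 0 < ψ.length := by
    rcases Nat.eq_zero_or_pos ψ.length with h0 | h0
    · exfalso
      have h1 : ψ = [] := List.length_eq_zero_iff.1 h0
      subst h1
      simp at hval
      linarith
    · exact h0
  rw [dif_pos hm]
  split_ifs with hacc
  · exact e3LC_mem_noSet hE.isWidthLE hε₁.le hε₁2 hval hm ((haccTest_eq_true_iff ψ).1 hacc) _ (kOf_spec hε₁ hε').1
  · exact hNO

/-- **The Karp reduction `gapE3SAT (1/8 - ε₁) ≤ₚ gapLabelCover (Wk ε₁ ε') ε'`, given a polynomial-time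
function computing `e3Inst ε₁ ε'` on codes** (`0 < ε₁ ≤ 1/8`, `0 < ε'`; nothing is required off the codes of
CNFs, since both sides of `gapE3SAT` consist of codes). [cite: AroraBarakCC2009, Thm. 22.15] -/
theorem polyTimeReducible_gapE3SAT_gapLabelCover {ε₁ : ℚ} (hε₁ : 0 < ε₁) (hε₁8 : ε₁ ≤ 1 / 8) {ε' : ℝ} (hε' : 0 < ε')
    (hF : ∃ f ∈ FP, ∀ ψ : CNF ℕ, f (encodingCNF.encode ψ) = LabelCoverInstance.encoding.encode (e3Inst ε₁ ε' ψ)) :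
    (gapE3SAT (1 / 8 - ε₁)).PolyTimeReducible (gapLabelCover (Wk ε₁ ε') ε') := by
  obtain ⟨f, hf, hspec⟩ := hF
  refine ⟨f, hf, ?_, ?_⟩
  · intro w hw
    rw [gapE3SAT_yes] at hw
    obtain ⟨ψ, ⟨hE, hsat⟩, rfl⟩ := hw
    rw [hspec, gapLabelCover_yes]
    exact ⟨e3Inst ε₁ ε' ψ, e3Inst_mem_yesSet _ _ hE hsat, rfl⟩
  · intro w hw
    rw [gapE3SAT_no] at hw
    obtain ⟨ψ, ⟨hE, hval⟩, rfl⟩ := hw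
    rw [hspec, gapLabelCover_no]
    have h8 : ((ε₁ : ℚ) : ℝ) ≤ 240 := by
      have h := (Rat.cast_le (K := ℝ)).2 hε₁8
      push_cast at h
      linarith
    have hvalR : ((ψ.maxSatFraction : ℚ) : ℝ) ≤ 1 - ε₁ := by
      have : ((ψ.maxSatFraction : ℚ) : ℝ) ≤ ((7 / 8 + (1 / 8 - ε₁) : ℚ) : ℝ) := by exact_mod_cast hval
      push_cast at this
      linarith
    exact ⟨e3Inst ε₁ ε' ψ, e3Inst_mem_noSet (by exact_mod_cast hε₁) h8 hε' hE hvalR, rfl⟩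

/-- **Gap label cover is NP-hard for every soundness error, from gap-E3SAT and the machines** (Arora–Barak
Thm. 22.15 in the form used downstream): if `gapE3SAT (1/8 - ε₁)` is NP-hard for some `0 < ε₁ ≤ 1/8` (the
PCP theorem, `GapAssembly.lean`) and every `e3Inst ε₁ ε'` (`ε' > 0`) is computed on codes by an `FP` function,
then for every `ε > 0` some `W` makes `gapLabelCover W ε` NP-hard. [cite: AroraBarakCC2009, Thm. 22.15; DinurSteurer2014, §3.3] -/
theorem isNPHard_gapLabelCover_forall_of_gapE3SAT {ε₁ : ℚ} (hε₁ : 0 < ε₁) (hε₁8 : ε₁ ≤ 1 / 8)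
    (hhard : (gapE3SAT (1 / 8 - ε₁)).IsNPHard)
    (hF : ∀ ε' : ℝ, 0 < ε' → ∃ f ∈ FP, ∀ ψ : CNF ℕ, f (encodingCNF.encode ψ) = LabelCoverInstance.encoding.encode (e3Inst ε₁ ε' ψ)) :
    ∀ ε : ℝ, 0 < ε → ∃ W : ℕ, (gapLabelCover W ε).IsNPHard := fun ε hε =>
  ⟨Wk ε₁ ε, PromiseProblem.IsHard.of_reducible_holds hhard (polyTimeReducible_gapE3SAT_gapLabelCover hε₁ hε₁8 hε (hF ε hε))⟩

end E3LC

end Expander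

end Literature.Computability.Complexity
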